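import Mathlib

/-!
# `PentagonInKZ`, line `edge-normal-newton-leibniz`: corner engine — word-level bounds
# of the dilated cubical integrands (aux file of the stub `cornerEngine_bounds`)

Aux file of the stub `cornerEngine_bounds` of the crux `PentagonInKZ`
(stmt-KontsevichZagierPeriods-11348, route FurushoPentagon), line `edge-normal-newton-leibniz`;
hook `cornerEngine_wordBounds`.  Pure real analysis; no KZ objects are involved.

For a letter type `L` with a distinguished ("regularised") letter `z` and a letter density
`φ : L → ℝ → ℝ → ℝ` (abscissa `t`, transverse parameter `p`) the DILATED CUBICAL WORD
INTEGRAND of a word `u : Fin n → L` at `x ∈ ℝⁿ` is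
`Q u x ξ p = ∏ᵢ [u i = z ? 1/xᵢ : (ξ x₀⋯x_{i-1}) · φ (u i) (ξ x₀⋯xᵢ) p]`,
with explicit `ξ`-derivative `dQ` (Leibniz rule, `∂ₜ φ = -φ²` formally).  Both are
hypothesised dictionaries (`Q` with `hQ`, `dQ` with `hdQ`), exactly as in the engine
statements, which use the two instances (letter `0`, `φ = fd`) and (letter `1`,
`φ k t p = gd k p t`).

* `CornerEngineBounds.prod_peel`, `CornerEngineBounds.sum_peel`: splitting off the outermost
  letter `a` and variable `x₀`,
  `Q (a u') (x₀ x') ξ = h · Q u' x' (ξ x₀)`, `h = [a = z ? 1/x₀ : ξ φ_a(ξ x₀)]`, and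
  `dQ (a u') (x₀ x') ξ = [a = z ? 0 : φ_a(ξx₀) - ξx₀ φ_a(ξx₀)²] · Q u' x' (ξx₀)
     + h x₀ · dQ u' x' (ξx₀)` (pure algebra of `Fin.cons`-indexed products);
* `cornerEngine_wordBounds` (the hook): if `|φ k| ≤ C₀` (`k ≠ z`) and `φ k t ·` is
  `C₀`-Lipschitz on the closed rectangle `[0, α] × [0, β]`, then for words whose LAST letter is
  not `z` and `x` in the closed unit cube, `|Q| ≤ C`, `|dQ| ≤ C`, `|Q| ≤ C ξ` (`n > 0`) and
  `|Q(p) - Q(p')| ≤ C ξ |p - p'|` with one constant per length.  Induction on the length: the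
  factor `1/x₀` of a leading letter `z` is compensated by the abscissa `ξ x₀` at which the
  (then non-empty) tail is evaluated, with the SAME constant since `ξ x₀ ≤ ξ`.

References: M. Kontsevich, D. Zagier, *Periods* (2001), §1.2 (the calculus these estimates
serve); the estimates themselves are folklore calculus.
-/

noncomputable section

namespace Summit.KontsevichZagierPeriods.FurushoPentagon.PentagonInKZ

namespace CornerEngineBounds

/-! ### Partial products along `Fin.cons` (adapted from `CornerEnginePeel`) -/

section FinProducts

variable {k : ℕ}

/-- `∏_{j < 0} x_j = 1` on `Fin (k+1)`. [folklore] -/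
theorem prod_filter_lt_zero (x : Fin (k + 1) → ℝ) :
    ∏ j ∈ Finset.univ.filter (fun j : Fin (k + 1) => j < 0), x j = 1 := by
  rw [Finset.prod_filter, Finset.prod_eq_one]
  intro j _
  rw [if_neg (Fin.not_lt_zero j)]

/-- `∏_{j ≤ 0} x_j = x₀` on `Fin (k+1)`. [folklore] -/
theorem prod_filter_le_zero (x : Fin (k + 1) → ℝ) :
    ∏ j ∈ Finset.univ.filter (fun j : Fin (k + 1) => j ≤ 0), x j = x 0 := by
  rw [Finset.prod_filter, Fin.prod_univ_succ, if_pos le_rfl, Finset.prod_eq_one, mul_one]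
  intro j _
  rw [if_neg (not_le.mpr (Fin.succ_pos j))]

/-- `∏_{j < i+1} (x₀ x')_j = x₀ ∏_{j < i} x'_j`. [folklore] -/
theorem prod_filter_lt_succ (x₀ : ℝ) (x' : Fin k → ℝ) (i : Fin k) :
    ∏ j ∈ Finset.univ.filter (fun j : Fin (k + 1) => j < i.succ),
        (Fin.cons x₀ x' : Fin (k + 1) → ℝ) j
      = x₀ * ∏ j ∈ Finset.univ.filter (fun j : Fin k => j < i), x' j := by
  rw [Finset.prod_filter, Finset.prod_filter, Fin.prod_univ_succ, if_pos (Fin.succ_pos i),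
    Fin.cons_zero]
  simp only [Fin.cons_succ, Fin.succ_lt_succ_iff]

/-- `∏_{j ≤ i+1} (x₀ x')_j = x₀ ∏_{j ≤ i} x'_j`. [folklore] -/
theorem prod_filter_le_succ (x₀ : ℝ) (x' : Fin k → ℝ) (i : Fin k) :
    ∏ j ∈ Finset.univ.filter (fun j : Fin (k + 1) => j ≤ i.succ),
        (Fin.cons x₀ x' : Fin (k + 1) → ℝ) j
      = x₀ * ∏ j ∈ Finset.univ.filter (fun j : Fin k => j ≤ i), x' j := by
  rw [Finset.prod_filter, Finset.prod_filter, Fin.prod_univ_succ, if_pos (Fin.succ_pos i).le,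
    Fin.cons_zero]
  simp only [Fin.cons_succ, Fin.succ_le_succ_iff]

/-- `∏_{i ≠ 0} f i = ∏_{i'} f (i'+1)` on `Fin (k+1)`. [folklore] -/
theorem prod_erase_zero {M : Type*} [CommMonoid M] (f : Fin (k + 1) → M) :
    ∏ i ∈ Finset.univ.erase 0, f i = ∏ i : Fin k, f i.succ := by
  rw [← Finset.filter_ne', Finset.prod_filter, Fin.prod_univ_succ]
  simp [Fin.succ_ne_zero]

/-- `∏_{i ≠ j+1} f i = f 0 · ∏_{i' ≠ j} f (i'+1)` on `Fin (k+1)`. [folklore] -/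
theorem prod_erase_succ {M : Type*} [CommMonoid M] (f : Fin (k + 1) → M) (j : Fin k) :
    ∏ i ∈ Finset.univ.erase j.succ, f i = f 0 * ∏ i ∈ Finset.univ.erase j, f i.succ := by
  rw [← Finset.filter_ne', Finset.prod_filter, Fin.prod_univ_succ, ← Finset.filter_ne',
    Finset.prod_filter]
  simp [(Fin.succ_ne_zero j).symm, Fin.succ_inj]

end FinProducts

/-! ### Peeling the outermost letter of the word integrand and of its derivative -/

section Peel

variable {L : Type} [DecidableEq L] (c : L) (φ : L → ℝ → ℝ) {k : ℕ} (a : L)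
  (u' : Fin k → L) (x₀ s : ℝ) (x' : Fin k → ℝ)

/-- Factorisation of the dilated cubical word integrand when the outermost letter `a` and the
outermost variable `x₀` are split off (adapted from `CornerEnginePeel.prod_peel`):
`q (a u') (x₀ x') s = [a = c ? 1/x₀ : s φ_a(s x₀)] · q u' x' (s x₀)`. [folklore] -/
theorem prod_peel :
    (∏ i : Fin (k + 1), if (Fin.cons a u' : Fin (k + 1) → L) i = c
        then 1 / (Fin.cons x₀ x' : Fin (k + 1) → ℝ) i
        else (s * ∏ j ∈ Finset.univ.filter (fun j => j < i),
            (Fin.cons x₀ x' : Fin (k + 1) → ℝ) j) *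
          φ ((Fin.cons a u' : Fin (k + 1) → L) i)
            (s * ∏ j ∈ Finset.univ.filter (fun j => j ≤ i),
              (Fin.cons x₀ x' : Fin (k + 1) → ℝ) j))
      = (if a = c then 1 / x₀ else s * φ a (s * x₀)) *
        ∏ i : Fin k, if u' i = c then 1 / x' i
          else ((s * x₀) * ∏ j ∈ Finset.univ.filter (fun j => j < i), x' j) *
            φ (u' i) ((s * x₀) * ∏ j ∈ Finset.univ.filter (fun j => j ≤ i), x' j) := by
  rw [Fin.prod_univ_succ]
  simp only [Fin.cons_zero, Fin.cons_succ, prod_filter_lt_zero, prod_filter_le_zero,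
    prod_filter_lt_succ, prod_filter_le_succ, mul_one, mul_assoc]

/-- Leibniz formula behind `prod_peel`: the explicit `s`-derivative of the word integrand of
`a u'` at `(x₀ x')` equals `[a = c ? 0 : φ_a(s x₀) - s x₀ φ_a(s x₀)²] · q u' x' (s x₀)
 + [a = c ? 1/x₀ : s φ_a(s x₀)] · x₀ · dq u' x' (s x₀)`. [folklore] -/
theorem sum_peel :
    (∑ j : Fin (k + 1), (if (Fin.cons a u' : Fin (k + 1) → L) j = c then 0 else
        (∏ j' ∈ Finset.univ.filter (fun j' => j' < j),
            (Fin.cons x₀ x' : Fin (k + 1) → ℝ) j') *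
            φ ((Fin.cons a u' : Fin (k + 1) → L) j)
              (s * ∏ j' ∈ Finset.univ.filter (fun j' => j' ≤ j),
                (Fin.cons x₀ x' : Fin (k + 1) → ℝ) j') -
          (s * ∏ j' ∈ Finset.univ.filter (fun j' => j' < j),
              (Fin.cons x₀ x' : Fin (k + 1) → ℝ) j') *
            (∏ j' ∈ Finset.univ.filter (fun j' => j' ≤ j),
              (Fin.cons x₀ x' : Fin (k + 1) → ℝ) j') *
              (φ ((Fin.cons a u' : Fin (k + 1) → L) j)
                (s * ∏ j' ∈ Finset.univ.filter (fun j' => j' ≤ j),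
                  (Fin.cons x₀ x' : Fin (k + 1) → ℝ) j')) ^ 2) *
        ∏ i ∈ Finset.univ.erase j, (if (Fin.cons a u' : Fin (k + 1) → L) i = c
          then 1 / (Fin.cons x₀ x' : Fin (k + 1) → ℝ) i
          else (s * ∏ j' ∈ Finset.univ.filter (fun j' => j' < i),
              (Fin.cons x₀ x' : Fin (k + 1) → ℝ) j') *
            φ ((Fin.cons a u' : Fin (k + 1) → L) i)
              (s * ∏ j' ∈ Finset.univ.filter (fun j' => j' ≤ i),
                (Fin.cons x₀ x' : Fin (k + 1) → ℝ) j')))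
      = (if a = c then 0 else φ a (s * x₀) - s * x₀ * φ a (s * x₀) ^ 2) *
          (∏ i : Fin k, if u' i = c then 1 / x' i
            else ((s * x₀) * ∏ j ∈ Finset.univ.filter (fun j => j < i), x' j) *
              φ (u' i) ((s * x₀) * ∏ j ∈ Finset.univ.filter (fun j => j ≤ i), x' j)) +
        (if a = c then 1 / x₀ else s * φ a (s * x₀)) * x₀ *
          ∑ j : Fin k, (if u' j = c then 0 else
            (∏ j' ∈ Finset.univ.filter (fun j' => j' < j), x' j') *
                φ (u' j)
                  ((s * x₀) * ∏ j' ∈ Finset.univ.filter (fun j' => j' ≤ j), x' j') -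
              ((s * x₀) * ∏ j' ∈ Finset.univ.filter (fun j' => j' < j), x' j') *
                (∏ j' ∈ Finset.univ.filter (fun j' => j' ≤ j), x' j') *
                  (φ (u' j)
                    ((s * x₀) * ∏ j' ∈ Finset.univ.filter (fun j' => j' ≤ j), x' j')) ^ 2) *
            ∏ i ∈ Finset.univ.erase j, (if u' i = c then 1 / x' i
              else ((s * x₀) * ∏ j' ∈ Finset.univ.filter (fun j' => j' < i), x' j') *
                φ (u' i)
                  ((s * x₀) * ∏ j' ∈ Finset.univ.filter (fun j' => j' ≤ i), x' j')) := by
  rw [Fin.sum_univ_succ]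
  congr 1
  · simp only [Fin.cons_zero, Fin.cons_succ, prod_filter_lt_zero, prod_filter_le_zero,
      prod_erase_zero, prod_filter_lt_succ, prod_filter_le_succ, mul_one, one_mul, mul_assoc]
  · rw [Finset.mul_sum]
    refine Finset.sum_congr rfl fun j _ => ?_
    simp only [Fin.cons_zero, Fin.cons_succ, prod_filter_lt_zero, prod_filter_le_zero,
      prod_erase_succ, prod_filter_lt_succ, prod_filter_le_succ, one_mul, mul_assoc]
    split_ifs <;> ring

end Peel

end CornerEngineBounds

open CornerEngineBounds in
/-- **Word-level bounds** (hook `cornerEngine_wordBounds` of the stub `cornerEngine_bounds`)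
for the dilated cubical word integrand
`Q u x ξ p = ∏ᵢ [u i = z ? 1/xᵢ : (ξ x₀⋯x_{i-1}) φ (u i) (ξ x₀⋯xᵢ) p]`
built from a letter density `φ` bounded by `C₀` (letters `≠ z`) and `C₀`-Lipschitz in the
transverse parameter `p` on `[0, α] × [0, β]`, and for its explicit `ξ`-derivative `dQ`: if
the LAST letter of `u` is not
the regularised letter `z`, then on the closed unit cube `|Q|, |dQ| ≤ C`, `|Q| ≤ C ξ`
(non-empty words) and `|Q(p) - Q(p')| ≤ C ξ |p - p'|`, with one constant `C` per length.
Induction on the length, peeling the outermost letter (`prod_peel`, `sum_peel`): the factor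
`1/x₀` of a leading letter `z` is compensated by the abscissa `ξ x₀` of the (then non-empty)
tail. [folklore] -/
theorem cornerEngine_wordBounds :
    ∀ {L : Type} [DecidableEq L] (z : L) (φ : L → ℝ → ℝ → ℝ) (α β C₀ : ℝ), 0 ≤ C₀ → (∀ k, k ≠ z → ∀ t p : ℝ, 0 ≤ t → t ≤ α → 0 ≤ p → p ≤ β → |φ k t p| ≤ C₀) → (∀ k (t p p' : ℝ), 0 ≤ t → t ≤ α → 0 ≤ p → p ≤ β → 0 ≤ p' → p' ≤ β → |φ k t p - φ k t p'| ≤ C₀ * |p - p'|) → ∀ (Q : ∀ {n : ℕ}, (Fin n → L) → (Fin n → ℝ) → ℝ → ℝ → ℝ), (∀ {n : ℕ} (u : Fin n → L) (x : Fin n → ℝ) (ξ p : ℝ), Q u x ξ p = ∏ i, if u i = z then 1 / x i else (ξ * ∏ j ∈ Finset.univ.filter (fun j => j < i), x j) * φ (u i) (ξ * ∏ j ∈ Finset.univ.filter (fun j => j ≤ i), x j) p) → ∀ (dQ : ∀ {n : ℕ}, (Fin n → L) → (Fin n → ℝ) → ℝ → ℝ → ℝ), (∀ {n : ℕ} (u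 : Fin n → L) (x : Fin n → ℝ) (ξ p : ℝ), dQ u x ξ p = ∑ j, (if u j = z then 0 else (∏ j' ∈ Finset.univ.filter (fun j' => j' < j), x j') * φ (u j) (ξ * ∏ j' ∈ Finset.univ.filter (fun j' => j' ≤ j), x j') p - (ξ * ∏ j' ∈ Finset.univ.filter (fun j' => j' < j), x j') * (∏ j' ∈ Finset.univ.filter (fun j' => j' ≤ j), x j') * (φ (u j) (ξ * ∏ j' ∈ Finset.univ.filter (fun j' => j' ≤ j), x j') p) ^ 2) * ∏ i ∈ Finset.univ.erase j, if u i = z then 1 / x i else (ξ * ∏ j' ∈ Finset.univ.filter (fun j' => j' < i), x j') * φ (u i) (ξ * ∏ j' ∈ Finset.univ.filter (fun j' => j' ≤ i), x j') p) → ∀ n : ℕ, ∃ C : ℝ, 0 ≤ C ∧ ∀ (u : Fin n → L) (x : Fin n → ℝ) (ξ p : ℝ), (List.ofFn u).getLast? ≠ some z → (∀ i, 0 ≤ x i ∧ x i ≤ 1) → 0 ≤ ξ → ξ ≤ α → 0 ≤ p → p ≤ β → |Q u x ξ p| ≤ C ∧ |dQ u x ξ p| ≤ C ∧ (0 < n →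 |Q u x ξ p| ≤ C * ξ) ∧ ∀ p' : ℝ, 0 ≤ p' → p' ≤ β → |Q u x ξ p - Q u x ξ p'| ≤ C * ξ * |p - p'| := by
  intro L _ z φ α β C₀ hC₀ hφb hφl Q hQ dQ hdQ n
  induction n with
  | zero =>
    refine ⟨1, zero_le_one, fun u x ξ p _ _ hξ _ _ _ => ?_⟩
    have hQ1 : ∀ q, Q u x ξ q = 1 := fun q => by rw [hQ]; simp
    have hdQ0 : dQ u x ξ p = 0 := by rw [hdQ]; simp
    refine ⟨by rw [hQ1]; simp, by rw [hdQ0]; simp, fun h => absurd h (lt_irrefl 0),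
      fun p' _ _ => ?_⟩
    rw [hQ1, hQ1, sub_self, abs_zero]
    positivity
  | succ k IH =>
    obtain ⟨C', hC'0, IH⟩ := IH
    -- the constants
    set A : ℝ := max α 1 with hA
    have hA1 : 1 ≤ A := le_max_right _ _
    have hA0 : 0 ≤ A := zero_le_one.trans hA1
    set C : ℝ := 3 * (A * C' * (1 + C₀) ^ 2) with hC
    have hK : C' * A ≤ C ∧ C' ≤ C ∧ A * (C₀ * C') ≤ C ∧ C₀ * C' ≤ C ∧
        (C₀ + A * C₀ ^ 2) * C' + A * C₀ * C' ≤ C ∧ C₀ * C' * A + C₀ * C' ≤ C := by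
      have P1 : 0 ≤ A * C' := mul_nonneg hA0 hC'0
      have P2 : 0 ≤ A * C' * C₀ := mul_nonneg P1 hC₀
      have P3 : 0 ≤ A * C' * C₀ ^ 2 := mul_nonneg P1 (sq_nonneg _)
      have P4 : 0 ≤ (A - 1) * C' := mul_nonneg (sub_nonneg.2 hA1) hC'0
      have P5 : 0 ≤ (A - 1) * C' * C₀ := mul_nonneg P4 hC₀
      have P6 : 0 ≤ (A - 1) * C' * C₀ ^ 2 := mul_nonneg P4 (sq_nonneg _)
      have P7 : 0 ≤ C' * C₀ := mul_nonneg hC'0 hC₀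
      have P8 : 0 ≤ C' * C₀ ^ 2 := mul_nonneg hC'0 (sq_nonneg _)
      refine ⟨?_, ?_, ?_, ?_, ?_, ?_⟩ <;> nlinarith [P1, P2, P3, P4, P5, P6, P7, P8, hC'0]
    have hCnn : 0 ≤ C := hC'0.trans hK.2.1
    refine ⟨C, hCnn, ?_⟩
    intro u x ξ p hu hx hξ0 hξα hp0 hpβ
    -- split off the outermost letter and the outermost variable
    obtain ⟨a, u', rfl⟩ : ∃ a u', u = Fin.cons a u' :=
      ⟨u 0, Fin.tail u, (Fin.cons_self_tail u).symm⟩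
    obtain ⟨x₀, x', rfl⟩ : ∃ x₀ x', x = Fin.cons x₀ x' :=
      ⟨x 0, Fin.tail x, (Fin.cons_self_tail x).symm⟩
    obtain ⟨hx00, hx01⟩ : 0 ≤ x₀ ∧ x₀ ≤ 1 := by simpa using hx 0
    have hx' : ∀ i, 0 ≤ x' i ∧ x' i ≤ 1 := fun i => by simpa using hx i.succ
    have hu' : (List.ofFn u').getLast? ≠ some z := by
      intro h; apply hu; rw [List.ofFn_cons, List.getLast?_cons, h]; rfl
    have hk : a = z → 0 < k := by
      intro haz
      rcases Nat.eq_zero_or_pos k with hk0 | hkpos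
      · exfalso; subst hk0; apply hu; rw [List.ofFn_cons, List.ofFn_zero, haz]; rfl
      · exact hkpos
    -- the smaller abscissa `ξ x₀`
    have hξ'0 : 0 ≤ ξ * x₀ := mul_nonneg hξ0 hx00
    have hξ'ξ : ξ * x₀ ≤ ξ := mul_le_of_le_one_right hξ0 hx01
    have hξ'α : ξ * x₀ ≤ α := hξ'ξ.trans hξα
    have hξA : ξ ≤ A := hξα.trans (le_max_left _ _)
    have hξ'A : ξ * x₀ ≤ A := hξ'ξ.trans hξA
    -- peeling identities
    have peelQ : ∀ q : ℝ, Q (Fin.cons a u') (Fin.cons x₀ x') ξ q =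
        (if a = z then 1 / x₀ else ξ * φ a (ξ * x₀) q) * Q u' x' (ξ * x₀) q := fun q => by
      rw [hQ, hQ]; exact prod_peel z (fun k t => φ k t q) a u' x₀ ξ x'
    have peeldQ : dQ (Fin.cons a u') (Fin.cons x₀ x') ξ p =
        (if a = z then 0 else φ a (ξ * x₀) p - ξ * x₀ * φ a (ξ * x₀) p ^ 2) *
            Q u' x' (ξ * x₀) p +
          (if a = z then 1 / x₀ else ξ * φ a (ξ * x₀) p) * x₀ *
            dQ u' x' (ξ * x₀) p := by
      rw [hdQ, hdQ, hQ]; exact sum_peel z (fun k t => φ k t p) a u' x₀ ξ x'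
    -- the induction hypothesis for the tail at the abscissa `ξ x₀`
    obtain ⟨hq, hdq, hqξ, hql⟩ := IH u' x' (ξ * x₀) p hu' hx' hξ'0 hξ'α hp0 hpβ
    have hq' : ∀ p', 0 ≤ p' → p' ≤ β → |Q u' x' (ξ * x₀) p'| ≤ C' :=
      fun p' h1 h2 => (IH u' x' (ξ * x₀) p' hu' hx' hξ'0 hξ'α h1 h2).1
    by_cases haz : a = z
    · -- leading regularised letter: factor `1/x₀`, the tail is non-empty
      have hkpos : 0 < k := hk haz
      rw [if_pos haz, if_pos haz, zero_mul, zero_add] at peeldQ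
      simp only [if_pos haz] at peelQ
      rcases hx00.eq_or_lt with hx0z | hx0pos
      · -- `x₀ = 0`: everything vanishes (`1/0 = 0`)
        subst hx0z
        have hQ0 : ∀ q, Q (Fin.cons a u') (Fin.cons 0 x') ξ q = 0 := fun q => by
          rw [peelQ q, div_zero, zero_mul]
        have hdQ0 : dQ (Fin.cons a u') (Fin.cons 0 x') ξ p = 0 := by
          rw [peeldQ, div_zero, zero_mul, zero_mul]
        refine ⟨?_, ?_, fun _ => ?_, fun p' _ _ => ?_⟩
        · rw [hQ0, abs_zero]; exact hCnn
        · rw [hdQ0, abs_zero]; exact hCnn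
        · rw [hQ0, abs_zero]; positivity
        · rw [hQ0, hQ0, sub_zero, abs_zero]; positivity
      · have hx0ne : x₀ ≠ 0 := hx0pos.ne'
        have hQle : |Q (Fin.cons a u') (Fin.cons x₀ x') ξ p| ≤ C' * ξ := by
          rw [peelQ p, abs_mul, abs_of_nonneg (by positivity : (0 : ℝ) ≤ 1 / x₀)]
          calc 1 / x₀ * |Q u' x' (ξ * x₀) p| ≤ 1 / x₀ * (C' * (ξ * x₀)) :=
                mul_le_mul_of_nonneg_left (hqξ hkpos) (by positivity)
            _ = C' * ξ := by field_simp
        refine ⟨hQle.trans ((mul_le_mul_of_nonneg_left hξA hC'0).trans hK.1), ?_,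
          fun _ => hQle.trans (mul_le_mul_of_nonneg_right hK.2.1 hξ0), fun p' hp'0 hp'β => ?_⟩
        · rw [peeldQ, one_div, inv_mul_cancel₀ hx0ne, one_mul]
          exact hdq.trans hK.2.1
        · rw [peelQ p, peelQ p', ← mul_sub, abs_mul,
            abs_of_nonneg (by positivity : (0 : ℝ) ≤ 1 / x₀)]
          calc 1 / x₀ * |Q u' x' (ξ * x₀) p - Q u' x' (ξ * x₀) p'|
              ≤ 1 / x₀ * (C' * (ξ * x₀) * |p - p'|) :=
                mul_le_mul_of_nonneg_left (hql p' hp'0 hp'β) (by positivity)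
            _ = C' * ξ * |p - p'| := by field_simp
            _ ≤ C * ξ * |p - p'| := by gcongr; exact hK.2.1
    · -- leading letter `a ≠ z`: factor `ξ φ_a(ξ x₀, p)`
      rw [if_neg haz, if_neg haz] at peeldQ
      simp only [if_neg haz] at peelQ
      set f : ℝ := φ a (ξ * x₀) p with hf_def
      have hf : |f| ≤ C₀ := hφb a haz _ _ hξ'0 hξ'α hp0 hpβ
      have hQabs : |Q (Fin.cons a u') (Fin.cons x₀ x') ξ p| =
          ξ * (|f| * |Q u' x' (ξ * x₀) p|) := by
        rw [peelQ p, abs_mul, abs_mul, abs_of_nonneg hξ0, mul_assoc]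
      have hfq : |f| * |Q u' x' (ξ * x₀) p| ≤ C₀ * C' :=
        mul_le_mul hf hq (abs_nonneg _) hC₀
      have hQξ : |Q (Fin.cons a u') (Fin.cons x₀ x') ξ p| ≤ ξ * (C₀ * C') := by
        rw [hQabs]; exact mul_le_mul_of_nonneg_left hfq hξ0
      refine ⟨hQξ.trans ((mul_le_mul_of_nonneg_right hξA (by positivity)).trans hK.2.2.1),
        ?_, fun _ => hQξ.trans ?_, fun p' hp'0 hp'β => ?_⟩
      · -- the derivative
        have t1 : |f - ξ * x₀ * f ^ 2| ≤ C₀ + A * C₀ ^ 2 := by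
          calc |f - ξ * x₀ * f ^ 2| ≤ |f| + |ξ * x₀ * f ^ 2| := abs_sub _ _
            _ = |f| + ξ * x₀ * |f| ^ 2 := by
                rw [abs_mul, abs_mul, abs_pow, abs_of_nonneg hξ0, abs_of_nonneg hx00]
            _ ≤ C₀ + A * 1 * C₀ ^ 2 := by gcongr
            _ = C₀ + A * C₀ ^ 2 := by ring
        have t2 : ξ * |f| * x₀ ≤ A * C₀ * 1 := by gcongr
        rw [peeldQ]
        calc |(f - ξ * x₀ * f ^ 2) * Q u' x' (ξ * x₀) p +
              ξ * f * x₀ * dQ u' x' (ξ * x₀) p|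
            ≤ |(f - ξ * x₀ * f ^ 2) * Q u' x' (ξ * x₀) p| +
                |ξ * f * x₀ * dQ u' x' (ξ * x₀) p| := abs_add_le _ _
          _ = |f - ξ * x₀ * f ^ 2| * |Q u' x' (ξ * x₀) p| +
                ξ * |f| * x₀ * |dQ u' x' (ξ * x₀) p| := by
              rw [abs_mul, abs_mul, abs_mul, abs_mul, abs_of_nonneg hξ0, abs_of_nonneg hx00]
          _ ≤ (C₀ + A * C₀ ^ 2) * C' + A * C₀ * 1 * C' :=
              add_le_add (mul_le_mul t1 hq (abs_nonneg _) (by positivity))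
                (mul_le_mul t2 hdq (abs_nonneg _) (by positivity))
          _ = (C₀ + A * C₀ ^ 2) * C' + A * C₀ * C' := by ring
          _ ≤ C := hK.2.2.2.2.1
      · -- order `ξ`
        rw [mul_comm]
        exact mul_le_mul_of_nonneg_right hK.2.2.2.1 hξ0
      · -- transverse Lipschitz bound
        set f' : ℝ := φ a (ξ * x₀) p' with hf'_def
        have hff' : |f - f'| ≤ C₀ * |p - p'| := hφl a _ _ _ hξ'0 hξ'α hp0 hpβ hp'0 hp'β
        rw [peelQ p, peelQ p']
        calc |ξ * f * Q u' x' (ξ * x₀) p - ξ * f' * Q u' x' (ξ * x₀) p'|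
            = ξ * |f * (Q u' x' (ξ * x₀) p - Q u' x' (ξ * x₀) p') +
                (f - f') * Q u' x' (ξ * x₀) p'| := by
              rw [← abs_of_nonneg hξ0, ← abs_mul, abs_of_nonneg hξ0]; congr 1; ring
          _ ≤ ξ * (|f| * |Q u' x' (ξ * x₀) p - Q u' x' (ξ * x₀) p'| +
                |f - f'| * |Q u' x' (ξ * x₀) p'|) := by
              refine mul_le_mul_of_nonneg_left ?_ hξ0
              simpa only [abs_mul] using
                abs_add_le (f * (Q u' x' (ξ * x₀) p - Q u' x' (ξ * x₀) p'))
                  ((f - f') * Q u' x' (ξ * x₀) p')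
          _ ≤ ξ * (C₀ * (C' * (ξ * x₀) * |p - p'|) + C₀ * |p - p'| * C') :=
              mul_le_mul_of_nonneg_left (add_le_add
                (mul_le_mul hf (hql p' hp'0 hp'β) (abs_nonneg _) hC₀)
                (mul_le_mul hff' (hq' p' hp'0 hp'β) (abs_nonneg _) (by positivity))) hξ0
          _ = ξ * |p - p'| * (C₀ * C' * (ξ * x₀) + C₀ * C') := by ring
          _ ≤ ξ * |p - p'| * (C₀ * C' * A + C₀ * C') := by gcongr
          _ ≤ ξ * |p - p'| * C := mul_le_mul_of_nonneg_left hK.2.2.2.2.2 (by positivity)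
          _ = C * ξ * |p - p'| := by ring

end Summit.KontsevichZagierPeriods.FurushoPentagon.PentagonInKZ
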